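import Literature.AnabelianGeometry.EtaleTheta.SettingModelChiThetaCusp
import Literature.AnabelianGeometry.EtaleTheta.SettingModelChiTwistInversion
import Literature.AnabelianGeometry.EtaleTheta.SettingModelSigmaHatFacts
import Literature.AnabelianGeometry.EtaleTheta.SettingModelChiCuspGroupLevel
import Literature.AnabelianGeometry.EtaleTheta.SettingModelChiCuspInertiaNotTheta
import Literature.AnabelianGeometry.EtaleTheta.Discharge.Sec2InertiaBinderOfHat
import Literature.AnabelianGeometry.EtaleTheta.Discharge.Sec2BarThetaCommutator
import Literature.AnabelianGeometry.EtaleTheta.Discharge.Sec1ThetaCompanionOfAut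
import HarnessLib

/-!
# NV TRUTH VALUES of the [EtTh] §2 census clauses at the χ-twisted stage-1 models `modelχ` / `modelχ′`
# (abc-iut-L2-lead R208; input of the 13:00Z v-next census)

S. Mochizuki, *The étale theta function and its Frobenioid-theoretic manifestations*, Publ. RIMS **45**
(2009) [EtTh], §2 pp. 35–37 (printed 261–263): Def. 2.1 and the discussion before it («`[Δ̄_X, Δ̄_X] =
Δ̄_Θ`», «`I_x ⊆ D_x` isomorphically onto `Δ̄_Θ`»), «`ι` … “multiplication by `−1`” … relative to choosing the
unique cusp of `X` as origin», Prop. 2.2 (i) («eigenvalues `−1` and `1`») [cite: MochizukiEtTh2009, Def 2.1 p.35].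

Cell abc-iut, layer L2, seat abc-iut-L2-t10 (gen 5). The STAGE-1 χ-twisted models of the [EtTh] §1 root are
abc-iut-L2-t1's `ThetaSetting.modelχ p` (F5b, `SettingModelChiTheta`: `Π^tp_X = Γ ⋊_χ G_{ℚ_p}`,
`Γ = F̂₂ ×_Ẑ ℤ`, `Π_X = F̂₂ ⋊_χ G_{ℚ_p}`, Krull topology on `G_{ℚ_p}`, no closed point) and abc-iut-w5-d029's
`ThetaSetting.modelχ′ p` (F5c, `SettingModelChiThetaCusp`: the same groups WITH the synthetic cusp
`D_x = b^Ẑ ⋊ G_{ℚ_p}`). This PROOF-ONLY file (0 definitions) records, as kernel theorems, the truth values of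
the §2 CENSUS CLAUSES (the hypothesis binders of the §2 cover layer) at these models, in the format of
abc-iut-w5-d118's p431045/p432019 and abc-iut-L2-t8's p433637. TABLE:

| clause (binder) | where it lives | modelχ | modelχ′ | decl |
|---|---|---|---|---|
| hΘ «`⁅Δ̂_X,Δ̂_X⁆ ⊔ barKerHat l = barThetaHat l`» (G-L2d3-1) | `ThetaSetting` | HOLDS (odd `l`) | HOLDS (odd `l`) | `hTheta_modelχ`, `hTheta_modelχ'` (abc-iut-L2-t11's `IsEtThOrigin.commutator_sup_barKerHat`) |
| (R1e′) «`ι̂ ≡ −1` on `Δ_X^ab`» for `ι := twistedInversionTop χ` (origin clause of hιell, G-L2t10-4 (a)) | `ThetaSetting` + `ι` | HOLDS | HOLDS | `twistedInversion_hinv_modelχ(′)`; riders (R1b′) `map_deltaTemp_…`, (R1c) `toZ_…`, over `G_K` `aug_…` |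
| «`ι` fixes the cusp's decomposition group» (X-side of (B2), «the cusp as origin») | `TemperedCurve` + cusp + `ι` | NOT-INSTANTIABLE (`Pt = ∅`) | HOLDS | `map_decomp_twistedInversion_modelχ'` |
| (P1) «`Ker(Π_X → G_K) = Δ̂_X`» (makes `Π_X ∩ Δ_C = Δ_X`, the consumer range of hιell) | `ThetaSetting` | HOLDS | HOLDS | `ker_augHat_modelχ` (= abc-iut-w5-d249's `deltaHatχ_eq`; w5-d029's `ker_augHat_modelχ'`) |
| inertia clause «`toHat(I_x) ⊔ barKerHat l = barThetaHat l`» (§1 side of hIx, G-L2t10-3) | `ThetaSetting` + cusp | NOT-INSTANTIABLE (`Pt = ∅`; vacuously ∀) | FAILS ∀ `l ≥ 2` | `isEmpty_pt_modelχ`, `not_inertiaClause_modelχ'` (transfer of p433801) |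
| (B1) `DC ⊓ tp Π_X = tp D_x`, (B2) `¬ DC ≤ tp Π_X`, (B3) `Comm(DC) ≤ DC`, hC1 (G-L2d3-2) | `TemperedCoverData` (`Π^tp_C`, `D^tp_{x_C}`) | NOT-INSTANTIABLE AT STAGE 1 | same | no `MuTwoSetting`/`CLevelData`/`TemperedCoverData` over `modelχ(′)` exists (stage 2 of abc-iut-L6-d6's R78 map: `Π^tp_C := Π^tp_X ⋊_ι ℤ/2`); the X-side shadow of (B2) HOLDS (row 3) |
| hιell / hιtheta / hIx CONSUMER forms (`PiCData.coverDataAx`) | `PiCData` over a `CLevelData` | NOT-INSTANTIABLE AT STAGE 1 | same | producers ready: hιell ⟸ (R1e′) row 2 via `CLevelData.piCData_inv_ell_of_hinv` (p432126); hιtheta via `inv_theta_of_inv_ell`; hIx ⟸ commutator-axis clause via `inertia_sup_barKer_of_commutatorAxis` (p434006) — the latter FAILS at `modelχ′` (row 5) |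

HONEST LIMITS: stage-1 semi-synthetic models, consistency evidence only (the synthetic cusp of `modelχ′`
is the TORAL `b`-axis, `SettingModelCuspAxis`); NOT-INSTANTIABLE means «the carrier of the clause is not
constructed in the tree at stage 1», not a claim of non-existence; nothing of [EtTh] is asserted; no new
`Prop` fact, no definition (the inversion is spelled `twistedInversionTop (chi p) (isInducing_leftRightχ p)`
throughout); zero edit of any other seat's file; no side is taken on [IUTchIII] Cor. 3.12; typed ≠ proved.
-/

noncomputable section

namespace Literature.AnabelianGeometry.EtaleTheta.SettingModel

open scoped commutatorElement
open Literature.AnabelianGeometry.SemiGraphs _root_.Topology _root_.Function ClassTwoBar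

variable (p : ℕ) [Fact p.Prime]

/-! ## §1. hΘ — HOLDS at both stage-1 models (odd `l`) -/

/-- **hΘ HOLDS at `modelχ`**: `⁅Δ̂_X, Δ̂_X⁆ ⊔ Ker(Δ_X ↠ Δ̄_X) = Δ̄_Θ`-preimage for every odd `l` — abc-iut-L2-t11's
`IsEtThOrigin.commutator_sup_barKerHat` at abc-iut-L2-t1's `modelχ_isEtThOrigin`. [cite: MochizukiEtTh2009, Def 2.1 p.35] -/
theorem hTheta_modelχ (l : ℕ) (hodd : Odd l) :
    ⁅(ThetaSetting.modelχ p).DeltaHat, (ThetaSetting.modelχ p).DeltaHat⁆ ⊔ (ThetaSetting.modelχ p).barKerHat l =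
      (ThetaSetting.modelχ p).barThetaHat l :=
  (ThetaSetting.modelχ_isEtThOrigin p).commutator_sup_barKerHat l hodd

/-- **hΘ HOLDS at `modelχ′`** (abc-iut-w5-d029's `modelχ'_isEtThOrigin`). [cite: MochizukiEtTh2009, Def 2.1 p.35] -/
theorem hTheta_modelχ' (l : ℕ) (hodd : Odd l) :
    ⁅(ThetaSetting.modelχ' p).DeltaHat, (ThetaSetting.modelχ' p).DeltaHat⁆ ⊔ (ThetaSetting.modelχ' p).barKerHat l =
      (ThetaSetting.modelχ' p).barThetaHat l :=
  (ThetaSetting.modelχ'_isEtThOrigin p).commutator_sup_barKerHat l hodd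

/-! ## §2. (R1e′) for the twisted inversion — HOLDS at both stage-1 models -/

/-- `σ̂` commutes with the `Ẑ^×`-twists through `χ` (abc-iut-w5-d024's `sigmaHat_twist`), in the shape
`SemidirectProduct.congr` wants. [cite: MochizukiEtTh2009, §2 p.36] -/
theorem actHatχ_trans_sigmaHatEquiv (σ : GQp p) :
    (actHatχ p σ).trans sigmaHatEquiv.toMulEquiv = sigmaHatEquiv.toMulEquiv.trans (actHatχ p σ) :=
  MulEquiv.ext fun x => sigmaHat_twist (chi p σ) x

/-- **The completed twisted inversion is `σ̂ ⋊ id` on `Π_X = F̂₂ ⋊_χ G_{ℚ_p}`**: for `ι := twistedInversionTop χ`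
on `Π^tp_X = Γ ⋊_χ G_{ℚ_p}`, `completionAut ι = SemidirectProduct.congr σ̂ id` (both are continuous and agree on
the dense image of `Π^tp_X`, where `pr₁ (ι_Γ γ) = σ̂ (pr₁ γ)`). [cite: MochizukiEtTh2009, §2 p.36] -/
theorem completionAut_twistedInversion_modelχ_apply (z : PiHtχ p) :
    (ThetaSetting.modelχ p).completionAut (twistedInversionTop (chi p) (isInducing_leftRightχ p)) z =
      SemidirectProduct.congr sigmaHatEquiv.toMulEquiv (MulEquiv.refl (GQp p)) (actHatχ_trans_sigmaHatEquiv p) z := by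
  set ι := twistedInversionTop (chi p) (isInducing_leftRightχ p) with hι
  let ΨE : PiHtχ p ≃* PiHtχ p :=
    SemidirectProduct.congr sigmaHatEquiv.toMulEquiv (MulEquiv.refl (GQp p)) (actHatχ_trans_sigmaHatEquiv p)
  have hΨc : Continuous ΨE := by
    rw [(isInducing_leftRightHatχ p).continuous_iff]
    have h : ((fun g : PiHtχ p => (g.left, g.right)) ∘ ΨE) =
        Prod.map sigmaHat id ∘ fun g : PiHtχ p => (g.left, g.right) := by
      funext g; rfl
    rw [h]
    exact (sigmaHat.continuous.prodMap continuous_id).comp (isInducing_leftRightHatχ p).continuous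
  let Ψ : PiHtχ p →ₜ* PiHtχ p := { toMonoidHom := ΨE.toMonoidHom, continuous_toFun := hΨc }
  let Φ : PiHtχ p →ₜ* PiHtχ p :=
    { toMonoidHom := ((ThetaSetting.modelχ p).completionAut ι).toMulEquiv.toMonoidHom
      continuous_toFun := ((ThetaSetting.modelχ p).completionAut ι).continuous }
  have hΦΨ : Φ = Ψ := by
    refine IsProfiniteCompletion.extension_unique (ThetaSetting.modelχ p).isProfiniteCompletion_toHat Φ Ψ fun x => ?_
    change (ThetaSetting.modelχ p).completionAut ι ((ThetaSetting.modelχ p).toHat x) =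
      ΨE ((ThetaSetting.modelχ p).toHat x)
    rw [TemperedCurve.completionAut_toHat]
    change toHatχ p (twistedInversion (chi p) x) = ΨE (toHatχ p x)
    exact SemidirectProduct.ext rfl rfl
  exact DFunLike.congr_fun (congrArg ContinuousMonoidHom.toMonoidHom hΦΨ) z

/-- On the normal factor: `ι̂ (inl x) = inl (σ̂ x)`. [cite: MochizukiEtTh2009, §2 p.36] -/
theorem completionAut_twistedInversion_modelχ_inl (x : F₂hatT) :
    (ThetaSetting.modelχ p).completionAut (twistedInversionTop (chi p) (isInducing_leftRightχ p))
        (SemidirectProduct.inl x) = SemidirectProduct.inl (sigmaHat x) := by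
  rw [completionAut_twistedInversion_modelχ_apply]
  exact SemidirectProduct.ext rfl rfl

/-- `inl : F̂₂ → Π_X` carries `⁅F̂₂, F̂₂⁆⁻` into `⁅Δ̂_X, Δ̂_X⁆⁻` (`inl(F̂₂) ⊆ Δ̂_X`, `inl` continuous).
[cite: MochizukiEtTh2009, §1 p.12] -/
theorem inl_mem_closure_commutator_deltaHatχ {y : F₂hatT} (hy : y ∈ (commutator F₂hatT).topologicalClosure) :
    (SemidirectProduct.inl y : PiHtχ p) ∈
      (⁅(curveχ p).DeltaHat, (curveχ p).DeltaHat⁆).topologicalClosure := by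
  have hle : (commutator F₂hatT).map (SemidirectProduct.inl : F₂hatT →* PiHtχ p) ≤
      ⁅(curveχ p).DeltaHat, (curveχ p).DeltaHat⁆ := by
    rw [commutator_def, Subgroup.map_commutator]
    have h : (⊤ : Subgroup F₂hatT).map (SemidirectProduct.inl : F₂hatT →* PiHtχ p) ≤ (curveχ p).DeltaHat := by
      rintro _ ⟨x, -, rfl⟩
      exact inl_mem_deltaHatχ p x
    exact Subgroup.commutator_mono h h
  have hsub : (SemidirectProduct.inl : F₂hatT → PiHtχ p) '' (commutator F₂hatT : Set F₂hatT) ⊆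
      ((⁅(curveχ p).DeltaHat, (curveχ p).DeltaHat⁆ : Subgroup (PiHtχ p)) : Set (PiHtχ p)) := by
    rintro _ ⟨x, hx, rfl⟩
    exact hle ⟨x, hx, rfl⟩
  have hmem : (SemidirectProduct.inl y : PiHtχ p) ∈
      closure ((SemidirectProduct.inl : F₂hatT → PiHtχ p) '' (commutator F₂hatT : Set F₂hatT)) := by
    refine image_closure_subset_closure_image (Semidirect.continuous_inl (isInducing_leftRightHatχ p)) ⟨y, ?_, rfl⟩
    rwa [← Subgroup.topologicalClosure_coe]
  have key := closure_mono hsub hmem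
  rwa [← Subgroup.topologicalClosure_coe] at key

/-- **(R1e′) HOLDS at `modelχ`**: for the twisted inversion `ι := twistedInversionTop χ` of `Π^tp_X = Γ ⋊_χ G_{ℚ_p}`,
`ι̂ g · g ∈ ⁅Δ̂_X, Δ̂_X⁆⁻` for every `g ∈ Δ̂_X` («`ι̂ ≡ −1` on `Δ_X^ab`», the C-level ORIGIN CLAUSE to which
G-L2t10-4 (a) hιell was reduced in `Discharge/Sec2InvEllOfCLevel`); the `F̂₂`-level input `σ̂(x)·x ∈ ⁅F̂₂,F̂₂⁆⁻`
is abc-iut-w5-d072's `sigmaHat_mul_self_mem_closure_commutator` (`SettingModelSigmaHatFacts`). [cite: MochizukiEtTh2009, Prop 2.2 (i) p.37] -/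
theorem twistedInversion_hinv_modelχ :
    ∀ g ∈ (ThetaSetting.modelχ p).DeltaHat,
      (ThetaSetting.modelχ p).completionAut (twistedInversionTop (chi p) (isInducing_leftRightχ p)) g * g ∈
        (⁅(ThetaSetting.modelχ p).DeltaHat, (ThetaSetting.modelχ p).DeltaHat⁆).topologicalClosure := by
  intro g hg
  have hg1 : g.right = 1 := right_eq_one_of_mem_deltaHatχ p hg
  have hgeq : g = SemidirectProduct.inl g.left := by
    rw [← SemidirectProduct.inl_left_mul_inr_right g, hg1, map_one, mul_one]
    rfl
  rw [hgeq, completionAut_twistedInversion_modelχ_inl, ← map_mul]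
  exact inl_mem_closure_commutator_deltaHatχ p (sigmaHat_mul_self_mem_closure_commutator g.left)

/-- (R1b′) rider at `modelχ`: `ι(Δ^tp_X) = Δ^tp_X` (`ι` is over `G_{ℚ_p}`). [cite: Mochizuki2012, Rmk 1.4.1 (ii) p.28] -/
theorem map_deltaTemp_twistedInversion_modelχ :
    (ThetaSetting.modelχ p).DeltaTemp.map
        (twistedInversionTop (chi p) (isInducing_leftRightχ p)).toMulEquiv.toMonoidHom =
      (ThetaSetting.modelχ p).DeltaTemp := by
  ext g
  constructor
  · rintro ⟨h, hh, rfl⟩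
    exact (mem_deltaTempχ_iff p _).mpr ((mem_deltaTempχ_iff p h).mp hh)
  · intro hg
    refine ⟨twistedInversion (chi p) g, (mem_deltaTempχ_iff p _).mpr ((mem_deltaTempχ_iff p g).mp hg), ?_⟩
    exact twistedInversion_twistedInversion (chi p) g

/-- Over-`G_K` rider at `modelχ`: `aug (ι g) = aug g`. [cite: Mochizuki2012, Rmk 1.4.1 (ii) p.28] -/
theorem aug_twistedInversion_modelχ (g : PiTpχ p) :
    (ThetaSetting.modelχ p).aug (twistedInversionTop (chi p) (isInducing_leftRightχ p) g) =
      (ThetaSetting.modelχ p).aug g := rfl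

/-- (R1c) rider at `modelχ`: `ι` REVERSES `Z` — `toZ (ι g) = (toZ g)⁻¹` (`toZ = pr₂ ∘ left`).
[cite: Mochizuki2012, Prop 2.2 (ii) p.66] -/
theorem toZ_twistedInversion_modelχ (g : PiTpχ p) :
    (ThetaSetting.modelχ p).toZ (twistedInversionTop (chi p) (isInducing_leftRightχ p) g) =
      ((ThetaSetting.modelχ p).toZ g)⁻¹ :=
  gfpSnd_left_twistedInversion (chi p) g

/-- `ι` is a nontrivial involution of `Π^tp_X` at `modelχ`. [cite: MochizukiEtTh2009, §2 p.36] -/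
theorem twistedInversion_involutive_ne_refl_modelχ :
    (∀ g : PiTpχ p, twistedInversionTop (chi p) (isInducing_leftRightχ p)
        (twistedInversionTop (chi p) (isInducing_leftRightχ p) g) = g) ∧
      twistedInversionTop (chi p) (isInducing_leftRightχ p) ≠ ContinuousMulEquiv.refl (PiTpχ p) := by
  refine ⟨fun g => twistedInversion_twistedInversion (chi p) g, fun h => ?_⟩
  exact twistedInversion_ne_refl (chi p) (MulEquiv.ext fun g => by
    change twistedInversionTop (chi p) (isInducing_leftRightχ p) g = g
    rw [h]; rfl)

/-- **(R1e′) HOLDS at `modelχ′`** (same `Π^tp_X`, `Π_X`, `toHat`, `Δ̂_X` as `modelχ`). [cite: MochizukiEtTh2009, Prop 2.2 (i) p.37] -/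
theorem twistedInversion_hinv_modelχ' :
    ∀ g ∈ (ThetaSetting.modelχ' p).DeltaHat,
      (ThetaSetting.modelχ' p).completionAut (twistedInversionTop (chi p) (isInducing_leftRightχ p)) g * g ∈
        (⁅(ThetaSetting.modelχ' p).DeltaHat, (ThetaSetting.modelχ' p).DeltaHat⁆).topologicalClosure :=
  twistedInversion_hinv_modelχ p

/-! ## §3. The inversion fixes the synthetic cusp of `modelχ′` — the X-side of (B2) HOLDS -/

/-- `ι_Γ (b^t, 0) = (b^{−t}, 0)`: the inversion maps the `b`-axis of `Γ` to itself (`σ̂ b^t = b^{−t}`,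
abc-iut-w5-d024's `sigmaHat_bPow`; cf. the stage-2 twin `gfpInv_bPowGfp` of `SettingModelTateInversion`, not
imported here). [cite: MochizukiEtTh2009, §2 p.36] -/
theorem gfpInv_bPowGfp_eq (t : ZH) : gfpInv (bPowGfp t) = bPowGfp t⁻¹ := by
  apply Subtype.ext
  rw [coe_gfpInv, coe_bPowGfp, coe_bPowGfp, sigmaHat_bPow, ← map_inv, inv_one]

/-- The inversion of `Γ` stabilises the `b`-axis `b^Ẑ ⊆ Γ`. [cite: MochizukiEtTh2009, §2 p.36] -/
theorem gfpInv_mem_bAxisGfp {q : Gfp} (hq : q ∈ bAxisGfp) : gfpInv q ∈ bAxisGfp := by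
  obtain ⟨t, rfl⟩ := hq
  exact ⟨t⁻¹, (gfpInv_bPowGfp_eq t).symm⟩

/-- **«`ι` fixes the origin» HOLDS at `modelχ′`**: the twisted inversion carries the decomposition group
`D_x = b^Ẑ ⋊ G_{ℚ_p}` of the synthetic cusp onto itself — the X-side content of (B2) / of print's «relative to
choosing the unique cusp of `X` as origin, `ι` is multiplication by `−1`». [cite: MochizukiEtTh2009, Def 2.1 p.36] -/
theorem map_decomp_twistedInversion_modelχ' (x : (ThetaSetting.modelχ' p).Pt) :
    ((ThetaSetting.modelχ' p).decomp x).map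
        (twistedInversionTop (chi p) (isInducing_leftRightχ p)).toMulEquiv.toMonoidHom =
      (ThetaSetting.modelχ' p).decomp x := by
  change (cuspDecompχ p).map _ = cuspDecompχ p
  ext g
  constructor
  · rintro ⟨h, hh, rfl⟩
    exact (mem_cuspDecompχ_iff p _).mpr (gfpInv_mem_bAxisGfp ((mem_cuspDecompχ_iff p h).mp hh))
  · intro hg
    refine ⟨twistedInversion (chi p) g, ?_, twistedInversion_twistedInversion (chi p) g⟩
    exact (mem_cuspDecompχ_iff p _).mpr (gfpInv_mem_bAxisGfp ((mem_cuspDecompχ_iff p g).mp hg))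

/-- … and fixes POINTWISE the canonical section `G_{ℚ_p} → D_x`, `σ ↦ inr σ`. [cite: Mochizuki2012, Rmk 1.4.1 (ii) p.28] -/
theorem twistedInversion_inr_modelχ (σ : GQp p) :
    twistedInversionTop (chi p) (isInducing_leftRightχ p) (SemidirectProduct.inr σ) = SemidirectProduct.inr σ :=
  twistedInversion_inr (chi p) σ

/-! ## §4. (P1) HOLDS; the inertia clause is NOT-INSTANTIABLE at `modelχ` and FAILS at `modelχ′` -/

/-- **(P1) HOLDS at `modelχ`**: `Ker(Π_X → G_{ℚ_p}) = Δ̂_X` (abc-iut-w5-d249's `deltaHatχ_eq`; at `modelχ′` this is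
abc-iut-w5-d029's `ker_augHat_modelχ'`). [cite: MochizukiEtTh2009, §1 p.12] -/
theorem ker_augHat_modelχ :
    (ThetaSetting.modelχ p).augHat.toMonoidHom.ker = (ThetaSetting.modelχ p).DeltaHat :=
  (deltaHatχ_eq p).symm

/-- **The inertia clause is NOT-INSTANTIABLE at `modelχ`**: there is no closed point (`Pt = ∅`) …
[cite: MochizukiEtTh2009, Def 2.1 p.35] -/
theorem isEmpty_pt_modelχ : IsEmpty (ThetaSetting.modelχ p).Pt := by
  change IsEmpty PEmpty
  infer_instance

/-- … so every statement quantified over cusps of `modelχ` holds vacuously (here: the inertia clause, both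
truth values). [cite: MochizukiEtTh2009, Def 2.1 p.35] -/
theorem inertiaClause_modelχ_vacuous (l : ℕ) :
    (∀ x : (ThetaSetting.modelχ p).Pt,
      ((ThetaSetting.modelχ p).inertia x).map (ThetaSetting.modelχ p).toHat.toMonoidHom ⊔
          (ThetaSetting.modelχ p).barKerHat l = (ThetaSetting.modelχ p).barThetaHat l) ∧
    ∀ x : (ThetaSetting.modelχ p).Pt,
      ¬ (((ThetaSetting.modelχ p).inertia x).map (ThetaSetting.modelχ p).toHat.toMonoidHom ⊔
          (ThetaSetting.modelχ p).barKerHat l = (ThetaSetting.modelχ p).barThetaHat l) :=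
  ⟨fun x => (isEmpty_pt_modelχ p).elim x, fun x => (isEmpty_pt_modelχ p).elim x⟩

/-- **The inertia clause FAILS at `modelχ′` for every `l ≥ 2`** (transfer of `not_inertiaClause_curveχ'`,
`SettingModelChiCuspInertiaNotTheta`: the synthetic inertia `b^Ẑ` maps non-trivially to `Δ̄^ell_X`).
[cite: MochizukiEtTh2009, Def 2.1 p.35] -/
theorem not_inertiaClause_modelχ' (l : ℕ) (hl : 2 ≤ l) (x : (ThetaSetting.modelχ' p).Pt) :
    ¬ (((ThetaSetting.modelχ' p).inertia x).map (ThetaSetting.modelχ' p).toHat.toMonoidHom ⊔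
        (ThetaSetting.modelχ' p).barKerHat l = (ThetaSetting.modelχ' p).barThetaHat l) :=
  not_inertiaClause_curveχ' p l hl x

/-- Hence at `modelχ′` the hIx binder of `PiCData.coverDataAx` has NO producer through the §1-side
clause, whatever `Π_C`-datum is later supplied: for every profinite input bundle `I` over `modelχ′` and every
once-punctured parameter `e`, the binder is FALSE (abc-iut-L2-t10's `inertia_sup_barKer_iff_inertia`, compact
`D_x = b^Ẑ ⋊ G_{ℚ_p}`). [cite: MochizukiEtTh2009, Def 2.1 p.35] -/
theorem not_hIx_modelχ' (l : ℕ) (hl : 2 ≤ l) {PiC : Type} [Group PiC] [TopologicalSpace PiC]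
    [IsTopologicalGroup PiC] [T2Space PiC] (I : (ThetaSetting.modelχ' p).PiCData PiC)
    (e : (ThetaSetting.modelχ' p).OncePuncturedData) (x : (ThetaSetting.modelχ' p).Pt) :
    ¬ ((I.Dx x ⊓ I.augGK.ker) ⊔ I.barKer l = I.barTheta l) := by
  have hcpt : IsCompact ((ThetaSetting.modelχ' p).decomp x : Set (PiTpχ p)) :=
    isCompact_cuspDecompχ p
  rw [I.inertia_sup_barKer_iff_inertia l e x hcpt]
  exact not_inertiaClause_modelχ' p l hl x

end Literature.AnabelianGeometry.EtaleTheta.SettingModel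

end
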